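import Summits.CriticalPhenomena.PercolationContinuityZ3.Theorems.PercNearOneGluingNoHeavyLowerTailBHKRowApexWiredTransfer
import HarnessLib

/-!
# `NoHeavyLowerTail` (stmt-CriticalPhenomena-4575) — the BHK row with terminal SETS for the random-cluster measure wired on a block containing the apex

Support file (prover prim-gen-kcluster gen 56; `--supports stmt-CriticalPhenomena-4575`).  No named facts, no sorries, no definitions.
Companion of `…BHKRowApexWired` (vertex terminals `b, c`): here the two terminals are vertex SETS `S, T ∌ a`.  For
`φ^B = rcMeasureW w q B`, `a ∈ B`, `q ≥ 1`, writing `a ↔ S` = "`a` is joined to some vertex of `S`", `S ↔ T` = "some vertex of `S` is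
joined to some vertex of `T`", and `S ↮ T off a` = "no vertex of `S` is joined to a vertex of `T` in `ω − a`":

  `φ^B(a∤S ∧ a∤T ∧ S∤T) · φ^B(a↔S ∧ a↔T ∧ S↮T off a) ≤ φ^B(a↔T ∧ a∤S ∧ S↮T off a) · φ^B(a↔S ∧ a∤T ∧ S↮T off a)`

(`bhkRowSets_rcMeasureW_apexWired`; gadget-block form `bhkRowSets_rcMeasureW_gadgetBlock`).  Unlike the vertex case, for sets the cell
`{a↔S, a∤T}` is not contained in `{S ↮ T off a}` (another vertex of `S` may reach `T`), so the right-hand cells keep the conjunct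
`S ↮ T off a`; dropping it only enlarges the right-hand side.  PROOF: the split-vertex two-set theorem on the pendant-path gadget graph
(`…ApexWiredGadget/Transfer`) for the old-port predicates, `exists_inl_port_set_iff`, and the cell algebra
`D ∩ {a↔S} = U′_S ⊔ T_a`, `D = Q ⊔ U′_S ⊔ U′_T ⊔ T_a`.

WHY (memo run/shared/lean/prim/prim-gen-kcluster/KCLUSTER-gen56.md §3 (3′)): under planar duality, R1 (`t·s_a ≤ u_b·u_c`) for `φ_{G,𝐩,q}`
WIRED on a set `B` of boundary vertices containing `a` and avoiding the open arc `b…c` becomes exactly this set row on the arc-split dual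
(the γ- and β-arcs are cut into several dual vertices by the pinched outer face; only the pieces adjacent to the apex arc are wired to it).
[cite: VandenbergHaggstromKahn2005, Thm. 1.4 (p. 7), Thm. 2.1 (p. 9)]
-/

noncomputable section

namespace Summit.CriticalPhenomena.PercolationContinuityZ3.Theorems

namespace PivotalBHK

namespace ApexWired

open Literature.Probability.Percolation Literature.Probability.Percolation.BHK2006
open Literature.Probability.LatticeModels SimpleGraph
open scoped Classical

variable {V Z : Type*}

/-! ### The BHK row with terminal SETS for the apex-wired measure -/

section RowSets

variable (a : V) (att : Z → V) (ω : BondConfig V)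

/-- **Set version of the old-port lemma**: for `a ∉ S`, the split cluster of `inl '' S` in the lift has a port at `inl a` through an
OLD pair iff `a ↔ s` in `ω` for some `s ∈ S`. [this work] -/
theorem exists_inl_port_set_iff {S : Set V} (haS : a ∉ S) :
    (∃ e ∈ splitCl (Sum.inl a) (liftCfg a att ω) (Sum.inl '' S), ∃ u : V, e = s(Sum.inl a, Sum.inl u)) ↔
      ∃ s ∈ S, (openGraph ω).Reachable a s := by
  constructor
  · rintro ⟨e, ⟨he, hd, x, hx, s', ⟨s, hs, rfl⟩, hsx⟩, u, rfl⟩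
    have hab : a ≠ s := fun h => haS (h ▸ hs)
    have hmem : s(Sum.inl a, Sum.inl u) ∈ splitCl (Sum.inl a) (liftCfg a att ω) {Sum.inl s} :=
      ⟨he, hd, x, hx, Sum.inl s, rfl, hsx⟩
    exact ⟨s, hs, (exists_inl_port_iff_reachable a att ω hab).1 ⟨_, hmem, u, rfl⟩⟩
  · rintro ⟨s, hs, hr⟩
    have hab : a ≠ s := fun h => haS (h ▸ hs)
    obtain ⟨e, ⟨he, hd, x, hx, s', hs', hsx⟩, u, hu⟩ := (exists_inl_port_iff_reachable a att ω hab).2 hr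
    rw [Set.mem_singleton_iff] at hs'
    subst hs'
    exact ⟨e, ⟨he, hd, x, hx, Sum.inl s, ⟨s, hs, rfl⟩, hsx⟩, u, hu⟩

variable [Fintype V] [Fintype Z]

open MeasureTheory in
/-- **BHK row with terminal SETS for `φ^B_{𝐩,q}`, `B = {a} ∪ att(Z)`, `q ≥ 1`.**  For vertex sets `S, T ∌ a`, write `a ↔ S` for "`a` is
joined to some vertex of `S`" and `S ↔ T` for "some vertex of `S` is joined to some vertex of `T`"; then
`φ^B(a∤S ∧ a∤T ∧ S∤T) · φ^B(a↔S ∧ a↔T ∧ S↮T off a) ≤ φ^B(a↔T ∧ a∤S ∧ S↮T off a) · φ^B(a↔S ∧ a∤T ∧ S↮T off a)`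
(and a fortiori with the last conjuncts `S ↮ T off a` dropped on the right).  For sets the cell `{a↔S, a∤T}` is NOT inside
`{S ↮ T off a}`, whence the refined right-hand cells; the proof is otherwise that of the vertex version.  Via planar duality this is R1
for `φ_{p,q}` WIRED on boundary vertices avoiding the arc `b…c` (memo KCLUSTER-gen56 §3). [cite: VandenbergHaggstromKahn2005, Thm. 1.4 (p. 7), Thm. 2.1 (p. 9)] -/
theorem bhkRowSets_rcMeasureW_gadgetBlock (w : Sym2 V → unitInterval) {q : ℝ} (hq : 1 ≤ q) {S T : Set V}
    (haS : a ∉ S) (haT : a ∉ T) :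
    (rcMeasureW w q (gadgetBlock a att)).real
        {ω : BondConfig V | (¬ ∃ s ∈ S, (openGraph ω).Reachable a s) ∧ (¬ ∃ t ∈ T, (openGraph ω).Reachable a t) ∧
          ¬ ∃ s ∈ S, ∃ t ∈ T, (openGraph ω).Reachable s t} *
        (rcMeasureW w q (gadgetBlock a att)).real {ω : BondConfig V | (∃ s ∈ S, (openGraph ω).Reachable a s) ∧
          (∃ t ∈ T, (openGraph ω).Reachable a t) ∧ ∀ s ∈ S, ∀ t ∈ T, ¬ (openGraph (delVertex a ω)).Reachable s t} ≤
      (rcMeasureW w q (gadgetBlock a att)).real {ω : BondConfig V | (∃ t ∈ T, (openGraph ω).Reachable a t) ∧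
          (¬ ∃ s ∈ S, (openGraph ω).Reachable a s) ∧ ∀ s ∈ S, ∀ t ∈ T, ¬ (openGraph (delVertex a ω)).Reachable s t} *
        (rcMeasureW w q (gadgetBlock a att)).real {ω : BondConfig V | (∃ s ∈ S, (openGraph ω).Reachable a s) ∧
          (¬ ∃ t ∈ T, (openGraph ω).Reachable a t) ∧ ∀ s ∈ S, ∀ t ∈ T, ¬ (openGraph (delVertex a ω)).Reachable s t} := by
  have hq0 : 0 < q := one_pos.trans_le hq
  haveI := isProbabilityMeasure_rcMeasureW w hq0 (gadgetBlock a att)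
  have haS' : (Sum.inl a : V ⊕ Z) ∉ Sum.inl '' S := fun ⟨s, hs, h⟩ => haS (Sum.inl_injective h ▸ hs)
  have haT' : (Sum.inl a : V ⊕ Z) ∉ Sum.inl '' T := fun ⟨t, ht, h⟩ => haT (Sum.inl_injective h ▸ ht)
  have key := BHK2006_twoSetConditionalAssociation_rc_splitVertex_negCorrelation_events (gadgetW w a att) hq haS' haT'
    (fun C => ∃ e ∈ C, ∃ u : V, e = s(Sum.inl a, Sum.inl u)) (fun C => ∃ e ∈ C, ∃ u : V, e = s(Sum.inl a, Sum.inl u))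
    (fun C C' hCC' ⟨e, he, hu⟩ => ⟨e, hCC' he, hu⟩)
    (fun C C' hCC' ⟨e, he, hu⟩ => ⟨e, hCC' he, hu⟩)
  simp only [rcMeasureW_real_gadget w a att hq0, Set.preimage_inter] at key
  set μ := rcMeasureW w q (gadgetBlock a att) with hμ
  set AS : Set (BondConfig V) := {ω | ∃ s ∈ S, (openGraph ω).Reachable a s} with hAS
  set AT : Set (BondConfig V) := {ω | ∃ t ∈ T, (openGraph ω).Reachable a t} with hAT
  set D : Set (BondConfig V) := {ω | ∀ s ∈ S, ∀ t ∈ T, ¬ (openGraph (delVertex a ω)).Reachable s t} with hD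
  have hDpre : liftCfg a att ⁻¹' {ω' : BondConfig (V ⊕ Z) | ∀ s ∈ Sum.inl '' S, ∀ t ∈ Sum.inl '' T,
      ¬ (openGraph (delVertex (Sum.inl a) ω')).Reachable s t} = D := by
    ext ω
    simp only [Set.mem_preimage, Set.mem_setOf_eq, Set.forall_mem_image, hD, reachable_delVertex_liftCfg_iff]
  have hAb : liftCfg a att ⁻¹' {ω' : BondConfig (V ⊕ Z) |
      ∃ e ∈ splitCl (Sum.inl a) ω' (Sum.inl '' S), ∃ u : V, e = s(Sum.inl a, Sum.inl u)} = AS := by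
    ext ω
    exact exists_inl_port_set_iff a att ω haS
  have hAc : liftCfg a att ⁻¹' {ω' : BondConfig (V ⊕ Z) |
      ∃ e ∈ splitCl (Sum.inl a) ω' (Sum.inl '' T), ∃ u : V, e = s(Sum.inl a, Sum.inl u)} = AT := by
    ext ω
    exact exists_inl_port_set_iff a att ω haT
  rw [hDpre, hAb, hAc] at key
  -- cells: T = D ∩ AS ∩ AT, U'_T = D ∩ AT \ AS, U'_S = D ∩ AS \ AT, Q = D \ (AS ∪ AT)
  set Tset : Set (BondConfig V) := {ω | (∃ s ∈ S, (openGraph ω).Reachable a s) ∧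
    (∃ t ∈ T, (openGraph ω).Reachable a t) ∧ ∀ s ∈ S, ∀ t ∈ T, ¬ (openGraph (delVertex a ω)).Reachable s t} with hTset
  set Ub : Set (BondConfig V) := {ω | (∃ t ∈ T, (openGraph ω).Reachable a t) ∧
    (¬ ∃ s ∈ S, (openGraph ω).Reachable a s) ∧ ∀ s ∈ S, ∀ t ∈ T, ¬ (openGraph (delVertex a ω)).Reachable s t} with hUb
  set Uc : Set (BondConfig V) := {ω | (∃ s ∈ S, (openGraph ω).Reachable a s) ∧
    (¬ ∃ t ∈ T, (openGraph ω).Reachable a t) ∧ ∀ s ∈ S, ∀ t ∈ T, ¬ (openGraph (delVertex a ω)).Reachable s t} with hUc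
  set Q : Set (BondConfig V) := {ω | (¬ ∃ s ∈ S, (openGraph ω).Reachable a s) ∧
    (¬ ∃ t ∈ T, (openGraph ω).Reachable a t) ∧ ¬ ∃ s ∈ S, ∃ t ∈ T, (openGraph ω).Reachable s t} with hQ
  have e1 : D ∩ (AS ∩ AT) = Tset := by
    ext ω
    simp only [Set.mem_inter_iff, hD, hAS, hAT, hTset, Set.mem_setOf_eq]
    constructor
    · rintro ⟨h, h1, h2⟩; exact ⟨h1, h2, h⟩
    · rintro ⟨h1, h2, h⟩; exact ⟨h, h1, h2⟩
  have e2 : D ∩ AS = Uc ∪ Tset := by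
    ext ω
    simp only [Set.mem_inter_iff, Set.mem_union, hD, hAS, hTset, hUc, Set.mem_setOf_eq]
    constructor
    · rintro ⟨h, h1⟩
      by_cases h2 : ∃ t ∈ T, (openGraph ω).Reachable a t
      · exact Or.inr ⟨h1, h2, h⟩
      · exact Or.inl ⟨h1, h2, h⟩
    · rintro (⟨h1, -, h⟩ | ⟨h1, -, h⟩) <;> exact ⟨h, h1⟩
  have e3 : D ∩ AT = Ub ∪ Tset := by
    ext ω
    simp only [Set.mem_inter_iff, Set.mem_union, hD, hAT, hTset, hUb, Set.mem_setOf_eq]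
    constructor
    · rintro ⟨h, h1⟩
      by_cases h2 : ∃ s ∈ S, (openGraph ω).Reachable a s
      · exact Or.inr ⟨h2, h1, h⟩
      · exact Or.inl ⟨h1, h2, h⟩
    · rintro (⟨h1, -, h⟩ | ⟨-, h1, h⟩) <;> exact ⟨h, h1⟩
  have e4 : D \ AS = Ub ∪ Q := by
    ext ω
    simp only [Set.mem_sdiff, Set.mem_union, hD, hAS, hUb, hQ, Set.mem_setOf_eq]
    constructor
    · rintro ⟨h, h1⟩
      by_cases h2 : ∃ t ∈ T, (openGraph ω).Reachable a t
      · exact Or.inl ⟨h2, h1, h⟩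
      · refine Or.inr ⟨h1, h2, ?_⟩
        rintro ⟨s, hs, t, ht, hst⟩
        exact h s hs t ht (reachable_delVertex_of_not_reachable hst fun h4 => h1 ⟨s, hs, h4.symm⟩)
    · rintro (⟨h1, h2, h⟩ | ⟨h1, h2, h3⟩)
      · exact ⟨h, h2⟩
      · refine ⟨fun s hs t ht hst => h3 ⟨s, hs, t, ht, hst.mono (openGraph_le (delVertex_subset a ω))⟩, h1⟩
  have d2 : Disjoint Uc Tset := Set.disjoint_left.2 fun ω h1 h2 => h1.2.1 h2.2.1
  have d3 : Disjoint Ub Tset := Set.disjoint_left.2 fun ω h1 h2 => h1.2.1 h2.1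
  have d4 : Disjoint Ub Q := Set.disjoint_left.2 fun ω h1 h2 => h2.2.1 h1.1
  have m2 : μ.real (D ∩ AS) = μ.real Uc + μ.real Tset := by
    rw [e2]; exact measureReal_union d2 (MeasurableSet.of_discrete)
  have m3 : μ.real (D ∩ AT) = μ.real Ub + μ.real Tset := by
    rw [e3]; exact measureReal_union d3 (MeasurableSet.of_discrete)
  have m4 : μ.real D = μ.real Uc + μ.real Tset + (μ.real Ub + μ.real Q) := by
    rw [← measureReal_inter_add_sdiff (MeasurableSet.of_discrete (s := AS)), m2, e4,
      measureReal_union d4 (MeasurableSet.of_discrete)]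
  rw [e1, m2, m3, m4] at key
  have hT : 0 ≤ μ.real Tset := measureReal_nonneg
  have hUb0 : 0 ≤ μ.real Ub := measureReal_nonneg
  have hUc0 : 0 ≤ μ.real Uc := measureReal_nonneg
  have hQ0 : 0 ≤ μ.real Q := measureReal_nonneg
  have hQ' : μ.real {ω : BondConfig V | (¬ ∃ s ∈ S, (openGraph ω).Reachable a s) ∧
      (¬ ∃ t ∈ T, (openGraph ω).Reachable a t) ∧ ¬ ∃ s ∈ S, ∃ t ∈ T, (openGraph ω).Reachable s t} = μ.real Q := rfl
  rw [hQ']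
  nlinarith [key]

open MeasureTheory in
/-- **BHK row with terminal SETS for `φ^B_{𝐩,q}`, every wired block `B ∋ a`, every `q ≥ 1`** (see
`bhkRowSets_rcMeasureW_gadgetBlock`). [cite: VandenbergHaggstromKahn2005, Thm. 1.4 (p. 7), Thm. 2.1 (p. 9)] -/
theorem bhkRowSets_rcMeasureW_apexWired (w : Sym2 V → unitInterval) {q : ℝ} (hq : 1 ≤ q) {S T : Set V}
    (haS : a ∉ S) (haT : a ∉ T) {B : Set V} (haB : a ∈ B) :
    (rcMeasureW w q B).real
        {ω : BondConfig V | (¬ ∃ s ∈ S, (openGraph ω).Reachable a s) ∧ (¬ ∃ t ∈ T, (openGraph ω).Reachable a t) ∧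
          ¬ ∃ s ∈ S, ∃ t ∈ T, (openGraph ω).Reachable s t} *
        (rcMeasureW w q B).real {ω : BondConfig V | (∃ s ∈ S, (openGraph ω).Reachable a s) ∧
          (∃ t ∈ T, (openGraph ω).Reachable a t) ∧ ∀ s ∈ S, ∀ t ∈ T, ¬ (openGraph (delVertex a ω)).Reachable s t} ≤
      (rcMeasureW w q B).real {ω : BondConfig V | (∃ t ∈ T, (openGraph ω).Reachable a t) ∧
          (¬ ∃ s ∈ S, (openGraph ω).Reachable a s) ∧ ∀ s ∈ S, ∀ t ∈ T, ¬ (openGraph (delVertex a ω)).Reachable s t} *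
        (rcMeasureW w q B).real {ω : BondConfig V | (∃ s ∈ S, (openGraph ω).Reachable a s) ∧
          (¬ ∃ t ∈ T, (openGraph ω).Reachable a t) ∧ ∀ s ∈ S, ∀ t ∈ T, ¬ (openGraph (delVertex a ω)).Reachable s t} := by
  haveI : Fintype ↥(B \ {a}) := Fintype.ofFinite _
  have hB : gadgetBlock a (Subtype.val : ↥(B \ {a}) → V) = B := by
    rw [gadgetBlock, Subtype.range_coe_subtype, Set.setOf_mem_eq, Set.insert_sdiff_singleton,
      Set.insert_eq_of_mem haB]
  have h := bhkRowSets_rcMeasureW_gadgetBlock a (Subtype.val : ↥(B \ {a}) → V) w hq haS haT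
  rwa [hB] at h

end RowSets

end ApexWired

end PivotalBHK

end Summit.CriticalPhenomena.PercolationContinuityZ3.Theorems

end
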